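import Literature.NumberTheory.ComplexMultiplication.CMDefinedOverNumberFieldOfQbar
import HarnessLib

/-!
# `stub_prop26` of line `a2-casselman-descent` from row II-2β (binder `h21` → `Hyp21`, Shimura 1998 Thm. 21.4)

Cell `hodgecm-mathlib` (D-0151 release track, ladder HODGECM-MATHLIB rung 0), fan A, rung A-II; crux item
stmt-HodgeConjecture-24834 (`H21`), registered skeleton `Cruxes/H21/Lines/a2_casselman_descent.lean`
(v4, sha 967d5f049a4290ca…), namespace `Summit.HodgeConjecture.CorCM.Cruxes.Hyp21.CasselmanDescent`.
Its registered FACT stub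

  `theorem stub_prop26 : shimura1998_prop26_definedOverNumberField`

(row II-2 = [Shimura1998, §12.4 Prop. 26] in the tree's form «a CM abelian variety over `ℂ` has an
`𝓞_K`-equivariant model over a NUMBER FIELD», `Literature/NumberTheory/ComplexMultiplication/ShimuraTaniyamaHecke.lean`)
is DERIVABLE from the sharper row II-2β `shimura1998_prop26_definedOverQbar` («… a model over `ℚ̄ ⊂ ℂ`»,
`CMDefinedOverQbar.lean`) by the Literature theorem
`Literature.NumberTheory.ComplexMultiplication.shimura1998_prop26_definedOverNumberField_of_definedOverQbar`
(B-p16, `CMDefinedOverNumberFieldOfQbar.lean`: EGA IV₃ 8.8.2 descent from `ℚ̄` to a number field + the base-change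
tower isomorphism).  This file is the fan-A JUNCTION recording that derivation against the stub's statement VERBATIM,
so that the planner can thread `shimura1998_prop26_definedOverQbar` as the residual fact stub of the line and close
`stub_prop26` by name.  No new mathematics; no named fact is USED unconditionally — the `ℚ̄`-form enters as the
explicit antecedent.  HC_CM is proved only modulo the 7 printed citations until rung 0 closes; this file only moves
row II-2's citation to its `ℚ̄`-form inside the `h21` line.

## References
* [Shimura1998] G. Shimura, *Abelian Varieties with Complex Multiplication and Modular Functions*, Princeton
  Univ. Press (1998), §12.4 Prop. 26 (p. 125), §21.4 Thm. 21.4 (p. 192).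
* [EGAIV3] A. Grothendieck, J. Dieudonné, *Éléments de géométrie algébrique* IV₃, Publ. Math. IHÉS 28 (1966),
  Thm. 8.8.2.
-/

set_option autoImplicit false

namespace Summit.HodgeConjecture.CorCM.Lines.A2CasselmanDescent

open Literature.NumberTheory.ComplexMultiplication

/-- **`stub_prop26` from row II-2β (junction, one token).**  Shimura–Taniyama §12.4 Prop. 26 in the registered
stub's form `shimura1998_prop26_definedOverNumberField` (an `𝓞_K`-equivariant model over a number field of every
CM abelian variety `(A, ι, θ)` of type `(K; Φ)` over `ℂ`) follows from its `ℚ̄`-form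
`shimura1998_prop26_definedOverQbar`; the consequent is the statement of `stub_prop26` of
`Cruxes/H21/Lines/a2_casselman_descent.lean` character for character.  Proof: B-p16's
`shimura1998_prop26_definedOverNumberField_of_definedOverQbar`.
[cite: Shimura1998, §12.4 Prop. 26] [cite: EGAIV3, Thm. 8.8.2] -/
theorem stubProp26_of_prop26Qbar :
    shimura1998_prop26_definedOverQbar → shimura1998_prop26_definedOverNumberField :=
  shimura1998_prop26_definedOverNumberField_of_definedOverQbar

end Summit.HodgeConjecture.CorCM.Lines.A2CasselmanDescent
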